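import Mathlib.Analysis.Complex.Schwarz
import Mathlib.Algebra.Order.Floor.Defs
import Mathlib.Analysis.SpecificLimits.Basic

/-!
# T⁴ programme, spine node NE1′ (O3b/H2), COUPLING LINE — the PATHWISE BLOCK BOUND: the abstract core of the route
# «bound the difference pathwise via the printed analyticity radii» for the merged road's one open leaf L8 ≡ (I)
# (`CovariantMeanSupply.StepSupply.contract`) of the skeletons `t4/skeletons/NE1p-t4-ne1p-p3.md` (v0.11 §3c) and
# `t4/skeletons/NE1p-t4-ne1p-p4.md` (v1.5 §3 L8, memo `t4/b2b-balaban-t4-ne1p-p4/L8-BLOCK.md`)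

Cell `pub-balaban`, unit `b2b-balaban-t4-ne1p-p3` (ROUND-2 technique-distinct prover #3 on BINDER row NE1′, technique «coupling
of block-spin towers: run the dressed and undressed towers on one probability space and bound the difference pathwise via the
printed analyticity radii»), generation 31.  OUR elementary lemmas (new work ⇒ `Summits/`), Mathlib only; everything is PROVED;
nothing is a `def … : Prop`; nothing of T. Bałaban's series is asserted.  Companions: this lineage's `Support/NE1pEquivariantSchwarz`
(p207071: equivariance + Schwarz on a normed BALL about the flat point) and road P4's `Support/CovariantMeanContraction`
(p207492: `norm_le_mul_ratio_of_vanishing`, the iteration `size_le_of_blockContraction`, the per-block rate `blockRate_le` with a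
SECOND-ORDER fluctuation summand `Cfl·q²`).  What is new here: (1) the Schwarz step is stated along ONE COMPLEX LINE into a bare
configuration TYPE (no norm, no ball: the printed analyticity spaces [Balaban1988Convergent] (2.34)–(2.39) p. 261 are not balls of
a normed space, but they do contain the complex line `t ↦ exp(iξ·t·𝒜̂)·(pure gauge)` of radius `(1−β)α_{1,j}` by condition (iii)
(2.39)); (2) the ONE-BLOCK bound is obtained by applying that step AT THE DISPLACED ACTUAL CONFIGURATION — displacement from flat
`≤ a + ρ`, `a` = depth flatness of the block's background (the factor `L^{−2s}` is printed INTO the domains: (2.35)/(2.37) p. 261),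
`ρ` = the accumulated REAL fluctuation displacement, bounded by the printed fluctuation cut-off `4δ_j`, `δ_j = (A₁/A₀)ε_j`
(p. 247 after (1.8) «δ₀ = g₀A₁p₀(g₀) = (A₁/A₀)ε₀. We assume that the constant A₀ is much larger than A₁»; p. 265 after (3.4)
«δ_k = g_kA₁/A₀p₀(g_k)»; p. 266 l. 3 «hence it can be bounded by 4δ_k») and NOT by the small-field radius `ε_j` — so the
fluctuation summand of the per-block rate is FIRST ORDER in `σ_j = 4Λδ_j/((1−β)α_{1,j})` and NO expansion in the fluctuation
fields is made; (3) the arithmetic showing that `σ_j = (4ΛA₁/((1−β)C₁))·ℓ_j^{p₀−q₁}`, `ℓ_j = log g_j⁻²`, is `γ`-small under the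
exponent premise `q₁ ≥ p₀ + 1` — a premise (2.28) p. 259 does NOT print («q₀, q₁ are integers greater than 1»); it is the cell's
RECONSTRUCTION (SMALLNESS.md §4.1 (X13)/(X14), kernel `B14Radii.fits_of_exponents`-type), recorded as such and used only as a
hypothesis.  CONSEQUENCE recorded in the skeleton (v0.11 §3c), NOT proved here: on this route the typed estimate (I)
`CrossScaleAnisotropy` (cross-scale isotropy of conditional laws, the located `(n+1)`), the second-order fluctuation expansion of
`L8-BLOCK.md` (b) and its LOCATED RISK R-P4-6 (`ε_j/α_{0,j}` not small) are NOT NEEDED; what remains own-open is PRINTED-TYPE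
(block expectation with one bounded local insertion: `‖T_sΦ‖ ≤ C_ins·sup_{support}‖Φ‖` and analyticity in the block data;
membership of the block's integrand configurations in the insertion's analyticity space = the inductive maintenance of (2.34)–(2.39),
p. 277; the `C¹ → C¹` response constant `Λ` of the minimisers [Balaban1985Variational]; junction/localisation (2.27)(iv)/(2.42);
ℝ-hits inside a block) plus the birth bound (WALL N4a/N4b) — all HYPOTHESES of the theorems below, asserted of no datum.

v1.1 (gen 31, same seat; declarations of v1 byte-identical, §4 APPENDED, this paragraph added).  LOCATOR UPGRADE after reading
B14 §3 pp. 266–268, 276–277 on the corpus text layer (skeleton v0.11.1 93187ddd09c7c24b): in a block without ℝ-hits the TRUE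
fluctuation field `A_k = (1/i)log V_k(V_k^{(k)})⁻¹` is cut off at `δ_k` by the SECOND decomposition of unity (3.16) p. 268
(«χ({b : |A_k(b)| < δ_k})», its complement joining the large-field regions), while (3.3) p. 265 cuts the APPROXIMATE field at
`2δ_k` and (3.13)–(3.14) p. 267 give the cruder global bound `|A′_k| < O(1)ε_k`, `O(1) = 4A₁/A₀ + (4dL)²(1+β₀)B₃` (local/global
minimiser discrepancy, itself `≤ 44d²B₃²(1+β₀)e^{−R_k}ε_k` by (3.17)–(3.19)); EITHER bound has polylog exponent `p₀`, so §3's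
fluctuation third is `γ`-small under `q₁ ≥ p₀ + 1` in both readings (`fluct_third_le` is stated with the letter `A₁`; read `A₁` or
`O(1)A₀`).  The membership input (β1) of the skeleton is B14 §3's own mechanism: (3.43) p. 276 — the step's terms are analytic on
«Ũᶜ_{k+1}(Y, (1+β)α̃₀, (1+β)α̃₁) × {A : supp A ⊂ Y∩Λ^{(k)*}_{k+1}, |A| < C₁p₁(g_k)}» (background of data in the ENLARGED new space
× COMPLEX fluctuation disc ⊃ the real cut-off), with the margin of p. 262.  NEW §4 supports (β2) (the LINE LEMMA): covariance
of `Φ` under REAL gauge transformations extends off the real axis along every complex one-parameter line by the ONE-VARIABLE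
identity theorem — `eqOn_of_eqOn_ofReal` (two functions `ℂ → F`, complex-differentiable on an open preconnected `U ∋ 0`, equal
at the real points of `U`, are equal on `U`; Mathlib `AnalyticOnNhd.eqOn_of_preconnected_of_frequently_eq` +
`DifferentiableOn.analyticOnNhd`) and its readings `apply_line_eq_of_ofReal` (reading: `γ t = C^{exp(tX)}` for a REAL Lie-algebra
direction `X`, `ρ t = Ad(exp(tX)(y))·Φ C`; real covariance (M1) ⇒ covariance for the imaginary directions `exp(isX)`, which with
the real ones generate a neighbourhood of the identity in the complexified gauge group) and `apply_line_eq_zero_of_ofReal` ((M3)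
extends: `Φ` vanishes at the complex pure gauges reached by such lines).  Nothing here asserts that Bałaban's spaces contain these
lines — that is the `β`-margin of p. 262, a hypothesis (`U` below).

HONEST FRAMING (T4-DAG p. 1).  Rung (B)+1 on ONE finite four-torus of fixed physical size; NOT infinite volume, NOT a mass gap,
NOT the Clay problem, NOT summit progress.  NE1′ is NOT printed and NOT proved (spine 0/9).  HONEST DEPENDENCY (verbatim):
continuum YM on T⁴ ⇐ BetaPertH ∧ nine spine estimates (0/9 proved); BetaPertH ⇐ (D1) ∧ (D4) ∧ CAP+tail; G-an2-4 gates asym, D1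
and NE2/3/4.

CITATION HEADER (pages READ this generation on the corpus text layer `paper:balaban1988-cmp119-convergent-renormalization`,
PDF pp. 5–6, 13, 15–16, 23–24 = journal pp. 247–248, 255, 257–258, 265–266; p. 261 (2.34)–(2.39) read in the verbatim transcript
of the tree module `Literature/…/Balaban1983to89/B14Radii.lean` docstring): [Balaban1988Convergent] = T. Bałaban, *Convergent
renormalization expansions for lattice gauge theories*, Comm. Math. Phys. **119** (1988) 243–285.  The quotations above are
LOCATORS of the objects the hypotheses speak about; no printed sentence is a hypothesis-free input (ABSOLUTE RULE).

WHAT IS PROVED ([folklore], Mathlib only).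
§1 `norm_le_div_mul_norm_of_line` / `norm_le_div_mul_of_line_real` — LINE SCHWARZ into a bare type `X`: `Φ ∘ γ` complex-
   differentiable and bounded by `N` on `ball 0 R₁ ⊂ ℂ`, `Φ (γ 0) = 0` ⇒ `‖Φ (γ t)‖ ≤ (N/R₁)·‖t‖`.
§2 `norm_le_of_lineReach`, `norm_block_le` / `norm_block_le_rate` — the ONE-BLOCK PATHWISE BOUND: an «insertion bound» `‖TΦ‖ ≤ C_ins·B` for every
   bound `B` of `Φ` on the support set `S`, every `x ∈ S` reached from a zero of `Φ` along an admissible line at real parameter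
   `d_x ≤ a + ρ < R₁` ⇒ `‖TΦ‖ ≤ C_ins·(N/R₁)·(a + ρ) = [C_ins·(a + ρ)/R₁]·N`; `sum_transport_le` — the accumulated displacement
   `Σ_{i<s} Λ_i δ_i ≤ Λ₀·δ̄/(1 − r)` for transports `Λ_i ≤ Λ₀rⁱ`, `r < 1` (deeper fluctuations arrive smoothed: no factor `s`).
§3 `blockRate_le_of_thirds` — `C_ins·(a + ρ)/R₁ + junc ≤ θ` from three thirds; `fluctRatio_eq` — with `δ = A₁·g·ℓ^{p₀}`,
   `α₁ = C₁·g·ℓ^{q₁}` the coupling `g` CANCELS: `4Λδ/((1−β)α₁) = (4ΛA₁/((1−β)C₁))·(ℓ^{p₀}/ℓ^{q₁})`; `pow_div_pow_le_inv` —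
   `q₁ ≥ p₀ + 1`, `ℓ ≥ 1` ⇒ `ℓ^{p₀}/ℓ^{q₁} ≤ ℓ⁻¹`; `div_le_of_ge_floor` / `fluct_third_le` — `K/ℓ ≤ η` for all `ℓ ≥ ℓ₀ := max 1 (K/η)`: the fluctuation
   third of the rate is met by `γ`-SMALLNESS alone (`ℓ_j ≥ log γ⁻²`), the weakest kind of condition in the cell's census.
§4 (v1.1) `eqOn_of_eqOn_ofReal`, `apply_line_eq_of_ofReal`, `apply_line_eq_zero_of_ofReal` — covariance / vanishing extend off
   the real axis along a complex line (one-variable identity theorem).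
-/

noncomputable section

open Metric Set
open scoped BigOperators

namespace Summit.QuantumFields.BalabanUV.T4Continuum.NE1pPathwiseBlock

/-! ## §1 Schwarz along one complex line into a bare configuration type -/

section Line

variable {X : Type*} {F : Type*} [NormedAddCommGroup F] [NormedSpace ℂ F]

/-- **LINE SCHWARZ.**  `X` is a bare type (Bałaban's configuration space carries no norm); `γ : ℂ → X` a complex line with
`Φ (γ 0) = 0` (reading: `γ t = exp(iξ·t·𝒜̂)·U_flat`, `Φ` covariant ⇒ zero at the pure gauge by Schur — `NE1pEquivariantSchwarz`,
`T4AdInvariant`); if `Φ ∘ γ` is complex-differentiable on `ball 0 R₁` and bounded by `N` there (reading: `R₁ = (1−β)α_{1,j}`, the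
innermost radius of condition (iii) (2.39) p. 261; `N` = the sup of `Φ` on its analyticity space), then
`‖Φ (γ t)‖ ≤ (N / R₁)·‖t‖` on that ball.  Mathlib's Schwarz lemma for `ℂ → F`. [folklore] -/
theorem norm_le_div_mul_norm_of_line {Φ : X → F} {γ : ℂ → X} {R₁ N : ℝ}
    (hd : DifferentiableOn ℂ (Φ ∘ γ) (ball 0 R₁)) (hN : ∀ t ∈ ball (0 : ℂ) R₁, ‖Φ (γ t)‖ ≤ N) (h0 : Φ (γ 0) = 0)
    {t : ℂ} (ht : t ∈ ball (0 : ℂ) R₁) : ‖Φ (γ t)‖ ≤ N / R₁ * ‖t‖ := by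
  have hmaps : MapsTo (Φ ∘ γ) (ball 0 R₁) (closedBall ((Φ ∘ γ) 0) N) := by
    intro u hu
    rw [mem_closedBall, dist_eq_norm, Function.comp_apply, Function.comp_apply, h0, sub_zero]
    exact hN u hu
  have h := Complex.dist_le_div_mul_dist_of_mapsTo_ball hd hmaps ht
  simpa [dist_eq_norm, h0] using h

/-- The same at a REAL parameter `d` (the size of the actual displacement from flat, measured in the units of the line):
`0 ≤ d < R₁` ⇒ `‖Φ (γ d)‖ ≤ (N / R₁)·d`. [folklore] -/
theorem norm_le_div_mul_of_line_real {Φ : X → F} {γ : ℂ → X} {R₁ N d : ℝ}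
    (hd : DifferentiableOn ℂ (Φ ∘ γ) (ball 0 R₁)) (hN : ∀ t ∈ ball (0 : ℂ) R₁, ‖Φ (γ t)‖ ≤ N) (h0 : Φ (γ 0) = 0)
    (hd0 : 0 ≤ d) (hdR : d < R₁) : ‖Φ (γ (d : ℂ))‖ ≤ N / R₁ * d := by
  have ht : ((d : ℂ)) ∈ ball (0 : ℂ) R₁ := by
    rw [mem_ball, dist_zero_right, Complex.norm_real, Real.norm_eq_abs, abs_of_nonneg hd0]
    exact hdR
  have h := norm_le_div_mul_norm_of_line hd hN h0 ht
  rwa [Complex.norm_real, Real.norm_eq_abs, abs_of_nonneg hd0] at h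

end Line

/-! ## §2 The one-block pathwise bound -/

section Block

variable {X : Type*} {F : Type*} [NormedAddCommGroup F] [NormedSpace ℂ F]

/-- **A SUPPORT POINT REACHED ALONG AN ADMISSIBLE LINE** (hypotheses, NOT a cited fact): the configuration `x` is reached
from a zero of `Φ` along a complex line `γ` on which `Φ` is differentiable and bounded by `N` up to radius `R₁`, at a real
parameter `d ≤ D < R₁` (reading: `d` = the layer-`j` `C¹`-size, in the axial gauge on the block's ball, of the deviation of the
ACTUAL fine configuration from pure gauge; `D = a + ρ`); then `‖Φ x‖ ≤ (N/R₁)·D`. [folklore] -/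
theorem norm_le_of_lineReach {Φ : X → F} {γ : ℂ → X} {N R₁ D d : ℝ} {x : X} (hN : 0 ≤ N) (hDR : D < R₁)
    (hd0 : 0 ≤ d) (hdD : d ≤ D) (hγx : γ (d : ℂ) = x) (h0 : Φ (γ 0) = 0)
    (hdiff : DifferentiableOn ℂ (Φ ∘ γ) (ball 0 R₁)) (hbd : ∀ t ∈ ball (0 : ℂ) R₁, ‖Φ (γ t)‖ ≤ N) :
    ‖Φ x‖ ≤ N / R₁ * D := by
  have hR : 0 < R₁ := lt_of_le_of_lt (hd0.trans hdD) hDR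
  rw [← hγx]
  calc ‖Φ (γ (d : ℂ))‖ ≤ N / R₁ * d := norm_le_div_mul_of_line_real hdiff hbd h0 hd0 (lt_of_le_of_lt hdD hDR)
    _ ≤ N / R₁ * D := mul_le_mul_of_nonneg_left hdD (div_nonneg hN hR.le)

/-- **THE ONE-BLOCK PATHWISE BOUND.**  Hypotheses (all SHAPES, asserted of no datum): an «insertion bound» for the block
expectation `TΦ` of the insertion `Φ` — `‖TΦ‖ ≤ C_ins·B` for EVERY bound `B` of `‖Φ‖` on the support set `S` of the block
integral (reading: positivity for real block data, `C_ins = 1`; for complex data the log-generating-function bound of the cluster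
expansion with one bounded local insertion, `C_ins = O(1)` — PRINTED-TYPE, own-open); every support configuration is reached along
an admissible line at parameter `≤ a + ρ < R₁` (reading: `a` = depth flatness of the `s`-step background, `≤ c_d·R·α_{0,j+s}·L^{−2s}`
by (2.35)/(2.37) p. 261; `ρ` = accumulated fluctuation displacement `≤ 4Λδ_j·L/(L−1)`, `sum_transport_le`).  Conclusion:
`‖TΦ‖ ≤ C_ins·(N/R₁)·(a + ρ)`.  NO expansion in the fluctuation fields, NO isotropy of conditional laws, NO `(n+1)`. [folklore] -/
theorem norm_block_le {S : Set X} {Φ : X → F} {TΦ : F} {Cins N R₁ a ρ : ℝ}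
    (hN : 0 ≤ N) (ha : 0 ≤ a) (hρ : 0 ≤ ρ) (hR : a + ρ < R₁)
    (hT : ∀ B : ℝ, (∀ x ∈ S, ‖Φ x‖ ≤ B) → ‖TΦ‖ ≤ Cins * B)
    (hreach : ∀ x ∈ S, ∃ γ : ℂ → X, ∃ d : ℝ, 0 ≤ d ∧ d ≤ a + ρ ∧ γ (d : ℂ) = x ∧ Φ (γ 0) = 0 ∧
      DifferentiableOn ℂ (Φ ∘ γ) (ball 0 R₁) ∧ ∀ t ∈ ball (0 : ℂ) R₁, ‖Φ (γ t)‖ ≤ N) :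
    ‖TΦ‖ ≤ Cins * (N / R₁ * (a + ρ)) := by
  have _ := ha; have _ := hρ
  refine hT _ fun x hx => ?_
  obtain ⟨γ, d, hd0, hdD, hγx, h0, hdiff, hbd⟩ := hreach x hx
  exact norm_le_of_lineReach hN hR hd0 hdD hγx h0 hdiff hbd

/-- The one-block bound in RATE FORM: `‖TΦ‖ ≤ κ·N` with `κ = C_ins·(a + ρ)/R₁` — the classical summand `C_ins·a/R₁` and the
FIRST-ORDER fluctuation summand `C_ins·ρ/R₁` of the skeleton's §3c (the input `hstep` of road P4's iteration
`CovariantMeanContraction.size_le_of_blockContraction`, junction summand aside). [folklore] -/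
theorem norm_block_le_rate {S : Set X} {Φ : X → F} {TΦ : F} {Cins N R₁ a ρ : ℝ}
    (hN : 0 ≤ N) (ha : 0 ≤ a) (hρ : 0 ≤ ρ) (hR : a + ρ < R₁)
    (hT : ∀ B : ℝ, (∀ x ∈ S, ‖Φ x‖ ≤ B) → ‖TΦ‖ ≤ Cins * B)
    (hreach : ∀ x ∈ S, ∃ γ : ℂ → X, ∃ d : ℝ, 0 ≤ d ∧ d ≤ a + ρ ∧ γ (d : ℂ) = x ∧ Φ (γ 0) = 0 ∧
      DifferentiableOn ℂ (Φ ∘ γ) (ball 0 R₁) ∧ ∀ t ∈ ball (0 : ℂ) R₁, ‖Φ (γ t)‖ ≤ N) :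
    ‖TΦ‖ ≤ Cins * ((a + ρ) / R₁) * N := by
  have h := norm_block_le hN ha hρ hR hT hreach
  calc ‖TΦ‖ ≤ Cins * (N / R₁ * (a + ρ)) := h
    _ = Cins * ((a + ρ) / R₁) * N := by ring

/-- **ACCUMULATED FLUCTUATION DISPLACEMENT** (arithmetic of the skeleton's `ρ`): if the `i`-th deeper fluctuation has size
`δ i ≤ δbar` and is transported to the insertion's layer with operator norm `Λ i ≤ Λ₀·rⁱ` (`0 ≤ r < 1`; reading `r = L⁻¹`:
a fluctuation of step `j+i` is smooth below its own scale, so its layer-`j` `C¹`-size carries `L^{−i}` — PRINTED-TYPE, a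
hypothesis here), then `Σ_{i<s} Λ i · δ i ≤ Λ₀·δbar/(1 − r)` for EVERY block length `s`: no factor `s`. [folklore] -/
theorem sum_transport_le {Λ δ : ℕ → ℝ} {Λ₀ δbar r : ℝ} (hΛ₀ : 0 ≤ Λ₀) (hδ0 : ∀ i, 0 ≤ δ i) (hδ : ∀ i, δ i ≤ δbar)
    (hΛ : ∀ i, Λ i ≤ Λ₀ * r ^ i) (hr0 : 0 ≤ r) (hr1 : r < 1) (s : ℕ) :
    ∑ i ∈ Finset.range s, Λ i * δ i ≤ Λ₀ * δbar / (1 - r) := by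
  have hδbar : 0 ≤ δbar := (hδ0 0).trans (hδ 0)
  have hterm : ∀ i, Λ i * δ i ≤ Λ₀ * δbar * r ^ i := by
    intro i
    calc Λ i * δ i ≤ Λ₀ * r ^ i * δbar := mul_le_mul (hΛ i) (hδ i) (hδ0 i) (by positivity)
      _ = Λ₀ * δbar * r ^ i := by ring
  calc ∑ i ∈ Finset.range s, Λ i * δ i ≤ ∑ i ∈ Finset.range s, Λ₀ * δbar * r ^ i := Finset.sum_le_sum fun i _ => hterm i
    _ = Λ₀ * δbar * ∑ i ∈ Finset.range s, r ^ i := by rw [Finset.mul_sum]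
    _ ≤ Λ₀ * δbar * (1 - r)⁻¹ := by
        refine mul_le_mul_of_nonneg_left ?_ (by positivity)
        rw [← tsum_geometric_of_lt_one hr0 hr1]
        exact (summable_geometric_of_lt_one hr0 hr1).sum_le_tsum (Finset.range s) fun i _ => pow_nonneg hr0 i
    _ = Λ₀ * δbar / (1 - r) := by rw [div_eq_mul_inv]

end Block

/-! ## §3 Rate arithmetic: three thirds; the coupling cancels in the fluctuation third; `γ`-smallness suffices -/

section Rate

/-- **THREE THIRDS.**  The per-block rate `C_ins·(a + ρ)/R₁ + junc` is `≤ θ` as soon as the classical summand, the first-order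
fluctuation summand and the junction summand are each `≤ θ/3` (reading: `θ = L^{−(1+δ′)s}`; the three side conditions of the
skeleton's §3c (N1′) `s ≥ s₀`, (N2′) `γ ≤ γ₀(s)`, (N3′) `R ≥ R₀(s)`). [folklore] -/
theorem blockRate_le_of_thirds {Cins a ρ R₁ junc θ : ℝ} (hcl : Cins * (a / R₁) ≤ θ / 3) (hfl : Cins * (ρ / R₁) ≤ θ / 3)
    (hj : junc ≤ θ / 3) : Cins * ((a + ρ) / R₁) + junc ≤ θ := by
  rw [add_div, mul_add]
  linarith

/-- **THE COUPLING CANCELS IN THE FLUCTUATION THIRD.**  With the printed SHAPES `δ = A₁·g·ℓ^{p₀}` (fluctuation cut-off,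
[Balaban1988Convergent] p. 247/265: `δ_j = (A₁/A₀)ε_j`, `ε_j = g_jA₀(log g_j⁻²)^{p₀}` (2.4) p. 255) and `α₁ = C₁·g·ℓ^{q₁}`
((2.28) p. 259), `ℓ = log g⁻² > 0`, `g > 0`: `4Λδ/((1−β)α₁) = (4ΛA₁/((1−β)C₁))·(ℓ^{p₀}/ℓ^{q₁})`. [folklore] -/
theorem fluctRatio_eq {Λ A₁ C₁ β g ℓ : ℝ} (p₀ q₁ : ℕ) (hg : g ≠ 0) (hℓ : ℓ ≠ 0) (hC : C₁ ≠ 0) (hβ : 1 - β ≠ 0) :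
    4 * Λ * (A₁ * g * ℓ ^ p₀) / ((1 - β) * (C₁ * g * ℓ ^ q₁))
      = 4 * Λ * A₁ / ((1 - β) * C₁) * (ℓ ^ p₀ / ℓ ^ q₁) := by
  have hq : ℓ ^ q₁ ≠ 0 := pow_ne_zero _ hℓ
  field_simp

/-- Under the exponent premise `p₀ + 1 ≤ q₁` (the cell's RECONSTRUCTION (X13)/(X14) of SMALLNESS.md §4.1 — NOT printed: (2.28)
p. 259 prints only «q₀, q₁ are integers greater than 1») and `1 ≤ ℓ`: `ℓ^{p₀}/ℓ^{q₁} ≤ ℓ⁻¹`. [folklore] -/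
theorem pow_div_pow_le_inv {ℓ : ℝ} {p₀ q₁ : ℕ} (hℓ : 1 ≤ ℓ) (hpq : p₀ + 1 ≤ q₁) : ℓ ^ p₀ / ℓ ^ q₁ ≤ ℓ⁻¹ := by
  have hℓ0 : 0 < ℓ := lt_of_lt_of_le zero_lt_one hℓ
  rw [div_le_iff₀ (pow_pos hℓ0 _), inv_mul_eq_div, le_div_iff₀ hℓ0, ← pow_succ]
  exact pow_le_pow_right₀ hℓ hpq

/-- Without the premise the third does not close by `γ`-smallness: if `q₁ ≤ p₀` and `1 ≤ ℓ` then `ℓ^{p₀}/ℓ^{q₁} ≥ 1` (it even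
grows like `ℓ^{p₀−q₁}` when `q₁ < p₀`) — the located reason the pathwise route WANTS `q₁ ≥ p₀ + 1` (and `q₀ = q₁` for the
classical third, skeleton §3c). [folklore] -/
theorem one_le_pow_div_pow {ℓ : ℝ} {p₀ q₁ : ℕ} (hℓ : 1 ≤ ℓ) (hqp : q₁ ≤ p₀) : 1 ≤ ℓ ^ p₀ / ℓ ^ q₁ := by
  have hℓ0 : 0 < ℓ := lt_of_lt_of_le zero_lt_one hℓ
  rw [le_div_iff₀ (pow_pos hℓ0 _), one_mul]
  exact pow_le_pow_right₀ hℓ hqp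

/-- **`γ`-SMALLNESS SUFFICES FOR THE FLUCTUATION THIRD.**  For a target `η > 0` put `ℓ₀ := max 1 (K/η)`; then
`K/ℓ ≤ η` for every `ℓ ≥ ℓ₀` (reading: `K = C_ins·4ΛA₁/((1−β)C₁)`, `η = θ/3`, `ℓ = log g_j⁻² ≥ log γ⁻² ≥ ℓ₀`, i.e.
`γ ≤ exp(−ℓ₀/2)` — a condition of the census's weakest kind, «g sufficiently small», imposed after `L, s, β, A₁, C₁, Λ`).
[folklore] -/
theorem div_le_of_ge_floor {K η ℓ : ℝ} (hη : 0 < η) (hℓ : max 1 (K / η) ≤ ℓ) : K / ℓ ≤ η := by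
  have hℓ1 : 1 ≤ ℓ := (le_max_left _ _).trans hℓ
  have hℓ0 : 0 < ℓ := lt_of_lt_of_le zero_lt_one hℓ1
  rw [div_le_iff₀ hℓ0]
  have h2 : K / η ≤ ℓ := (le_max_right _ _).trans hℓ
  rw [div_le_iff₀ hη] at h2
  linarith [mul_comm η ℓ]

/-- The fluctuation third assembled: with `δ`, `α₁` of the printed shapes, `p₀ + 1 ≤ q₁`, and `ℓ ≥ max 1 (K/η)` for
`K = C_ins·(4ΛA₁/((1−β)C₁))`, the summand `C_ins·(4Λδ/((1−β)α₁))` is `≤ η`. [folklore] -/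
theorem fluct_third_le {Cins Λ A₁ C₁ β g ℓ η : ℝ} {p₀ q₁ : ℕ} (hCins : 0 ≤ Cins) (hΛ : 0 ≤ Λ) (hA : 0 ≤ A₁) (hC : 0 < C₁)
    (hβ : β < 1) (hg : 0 < g) (hη : 0 < η) (hpq : p₀ + 1 ≤ q₁)
    (hℓ : max 1 (Cins * (4 * Λ * A₁ / ((1 - β) * C₁)) / η) ≤ ℓ) :
    Cins * (4 * Λ * (A₁ * g * ℓ ^ p₀) / ((1 - β) * (C₁ * g * ℓ ^ q₁))) ≤ η := by
  have hℓ1 : 1 ≤ ℓ := (le_max_left _ _).trans hℓ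
  have hℓ0 : 0 < ℓ := lt_of_lt_of_le zero_lt_one hℓ1
  have hK : 0 ≤ Cins * (4 * Λ * A₁ / ((1 - β) * C₁)) := by
    have : 0 < (1 - β) * C₁ := mul_pos (by linarith) hC
    positivity
  rw [fluctRatio_eq p₀ q₁ hg.ne' hℓ0.ne' hC.ne' (by linarith)]
  calc Cins * (4 * Λ * A₁ / ((1 - β) * C₁) * (ℓ ^ p₀ / ℓ ^ q₁))
      = Cins * (4 * Λ * A₁ / ((1 - β) * C₁)) * (ℓ ^ p₀ / ℓ ^ q₁) := by ring
    _ ≤ Cins * (4 * Λ * A₁ / ((1 - β) * C₁)) * ℓ⁻¹ :=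
        mul_le_mul_of_nonneg_left (pow_div_pow_le_inv hℓ1 hpq) hK
    _ = Cins * (4 * Λ * A₁ / ((1 - β) * C₁)) / ℓ := by ring
    _ ≤ η := div_le_of_ge_floor hη hℓ

/-- **THE CLASSICAL THIRD** in closed form (skeleton §3c (N1′)): with the depth flatness `a = c_d·R·α₀'·L^{−2s}` PRINTED INTO
the domains ((2.35)/(2.37) p. 261: the layer-`j` minimal configuration of layer-`(j+s)` data obeys the layer-`(j+s)` radius
`α₀' = α_{0,j+s}` times `L^{−2s}`) and the line radius `R₁ = (1−β)·α₁`, `α₁ = α_{1,j}`: the summand is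
`C_ins·c_d·R·(α₀'/α₁)/(1−β)·L^{−2s}` — a CONSTANT (the radii ratio is `O(C₀/C₁)` for `q₀ = q₁` by (2.6)–(2.9) p. 255) times
`L^{−2s}`, met by `s ≥ s₀`; no `B₃` and no `ε/α₀` appear. [folklore] -/
theorem classical_third_eq {Cins c_d R α₀' α₁ β L : ℝ} (s : ℕ) (hα : α₁ ≠ 0) (hβ : 1 - β ≠ 0) (hL : L ≠ 0) :
    Cins * (c_d * R * α₀' * (L ^ (2 * s))⁻¹ / ((1 - β) * α₁))
      = Cins * c_d * R * (α₀' / α₁) / (1 - β) * (L ^ (2 * s))⁻¹ := by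
  have hL2 : L ^ (2 * s) ≠ 0 := pow_ne_zero _ hL
  field_simp

/-- The classical third is met by block length: if `C·(L²)⁻ˢ·… ≤ θ/3` is wanted with `θ = (L^{1+δ′})^{-s}`-type targets, it is
enough that the constant obeys `C ≤ (θ/3)·L^{2s}`; stated as the trivial rearrangement used by the skeleton. [folklore] -/
theorem classical_third_le {C L θ : ℝ} (s : ℕ) (hL : 0 < L) (hC : C ≤ θ / 3 * L ^ (2 * s)) :
    C * (L ^ (2 * s))⁻¹ ≤ θ / 3 := by
  have hL2 : 0 < L ^ (2 * s) := pow_pos hL _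
  rw [← div_eq_mul_inv, div_le_iff₀ hL2]
  exact hC

end Rate

/-! ## §4 (v1.1) Covariance and vanishing extend off the real axis along a complex line -/

section OffRealAxis

open Filter Topology

variable {X : Type*} {F : Type*} [NormedAddCommGroup F] [NormedSpace ℂ F] [CompleteSpace F]

/-- **ONE-VARIABLE IDENTITY THEOREM FROM THE REAL AXIS.**  Two functions `ℂ → F`, complex-differentiable on an open preconnected
set `U ∋ 0`, which agree at every REAL point of `U`, agree on all of `U` (the real points of `U` accumulate at `0`).  Mathlib's
`AnalyticOnNhd.eqOn_of_preconnected_of_frequently_eq` + `DifferentiableOn.analyticOnNhd`. [folklore] -/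
theorem eqOn_of_eqOn_ofReal {f g : ℂ → F} {U : Set ℂ} (hU : IsOpen U) (hconn : IsPreconnected U) (h0 : (0 : ℂ) ∈ U)
    (hf : DifferentiableOn ℂ f U) (hg : DifferentiableOn ℂ g U) (hreal : ∀ t : ℝ, (t : ℂ) ∈ U → f t = g t) :
    EqOn f g U := by
  refine AnalyticOnNhd.eqOn_of_preconnected_of_frequently_eq (hf.analyticOnNhd hU) (hg.analyticOnNhd hU) hconn h0 ?_
  rw [Filter.frequently_iff]
  intro V hV
  obtain ⟨ε, hε, hV'⟩ := Metric.mem_nhdsWithin_iff.mp hV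
  obtain ⟨ε', hε', hU'⟩ := Metric.isOpen_iff.mp hU 0 h0
  set t : ℝ := min ε ε' / 2 with ht_def
  have htpos : 0 < t := by rw [ht_def]; positivity
  have htε : t < ε := by
    rw [ht_def]; linarith [min_le_left ε ε']
  have htε' : t < ε' := by
    rw [ht_def]; linarith [min_le_right ε ε']
  have hnorm : ‖(t : ℂ)‖ = t := by rw [Complex.norm_real, Real.norm_eq_abs, abs_of_pos htpos]
  have htU : ((t : ℂ)) ∈ U := hU' (by rw [mem_ball, dist_zero_right, hnorm]; exact htε')
  refine ⟨(t : ℂ), hV' ⟨?_, ?_⟩, hreal t htU⟩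
  · rw [mem_ball, dist_zero_right, hnorm]; exact htε
  · rw [Set.mem_compl_iff, Set.mem_singleton_iff]
    exact_mod_cast htpos.ne'

/-- **COVARIANCE EXTENDS OFF THE REAL AXIS** (skeleton (β2), the LINE LEMMA's covariance input).  `Φ : X → F` on a bare
configuration type; `γ : ℂ → X` a complex line (reading: `γ t = C^{exp(tX)}`, the orbit of a configuration `C` under the
one-parameter group of gauge transformations generated by a REAL Lie-algebra-valued field `X`); `ρ : ℂ → F` the covariant
prediction (reading: `ρ t = Ad(exp(tX)(y))·Φ C`, entire in `t`).  If `Φ ∘ γ` and `ρ` are complex-differentiable on an open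
preconnected `U ∋ 0` (reading: the `β`-margin of [Balaban1988Convergent] p. 262 keeps `γ t` inside `Φ`'s analyticity space
for `t ∈ U`) and agree at the real points of `U` (reading: covariance (M1) under G-VALUED gauge transformations), then they agree
on `U` — covariance for the IMAGINARY directions `exp(isX)`; together with the real ones these generate a neighbourhood of the
identity in the complexified gauge group. [folklore] -/
theorem apply_line_eq_of_ofReal {Φ : X → F} {γ : ℂ → X} {ρ : ℂ → F} {U : Set ℂ} (hU : IsOpen U)
    (hconn : IsPreconnected U) (h0 : (0 : ℂ) ∈ U) (hΦ : DifferentiableOn ℂ (Φ ∘ γ) U) (hρ : DifferentiableOn ℂ ρ U)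
    (hreal : ∀ t : ℝ, (t : ℂ) ∈ U → Φ (γ t) = ρ t) {t : ℂ} (ht : t ∈ U) : Φ (γ t) = ρ t :=
  eqOn_of_eqOn_ofReal hU hconn h0 hΦ hρ (fun s hs => hreal s hs) ht

/-- **VANISHING EXTENDS OFF THE REAL AXIS** ((M3) extended): if `Φ ∘ γ` is complex-differentiable on an open preconnected
`U ∋ 0` and vanishes at the real points of `U` (reading: `γ t` = the image of a REAL pure gauge under `exp(tX)`, a pure gauge
for real `t`, where the covariant `Φ` vanishes by Schur), then `Φ (γ t) = 0` on `U` — `Φ` vanishes at the COMPLEX pure gauges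
reached by such lines, the zeros from which §2's admissible lines start. [folklore] -/
theorem apply_line_eq_zero_of_ofReal {Φ : X → F} {γ : ℂ → X} {U : Set ℂ} (hU : IsOpen U) (hconn : IsPreconnected U)
    (h0 : (0 : ℂ) ∈ U) (hΦ : DifferentiableOn ℂ (Φ ∘ γ) U) (hreal : ∀ t : ℝ, (t : ℂ) ∈ U → Φ (γ t) = 0) {t : ℂ}
    (ht : t ∈ U) : Φ (γ t) = 0 :=
  apply_line_eq_of_ofReal (ρ := fun _ => 0) hU hconn h0 hΦ (differentiableOn_const 0) hreal ht

end OffRealAxis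

end Summit.QuantumFields.BalabanUV.T4Continuum.NE1pPathwiseBlock
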